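import Literature.Computability.MetaComplexity.EFModMulUCommF
import HarnessLib

/-!
# Commutativity of uniform modular multiplication, part B2: the stage

Layer E/6 (uniform variant). Stage `s` of the commutativity induction: from
`a ⊗ B_s ≡ B_s ⊗ a` (as the equalities of the output of `M_s` with the outputs of `LD1_s`'s
`VX` and `VY`) derive `a ⊗ B_{s+1} ≡ B_{s+1} ⊗ a` (for the next instances `N`, `N'` on the
operands `(B_{s+1}, a, n)` — `LD1_{s+1}`'s `VX`, `VY`, or `BA` at the last stage). The block:
the word facts (part B1), the two distributivity laws, the unit law on `u_s ⊗ a`, the shift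
law on `M_s`, `M_{s+1}`, and the algebra of congruences linking
`M_{s+1} = R(P_L(M_s) ⊕ P_L(M_s)) ⊕ (b' ∧ a)` with
`B_{s+1} ⊗ a = ((B_s ⊗ a ⊕ B_s ⊗ a) ⊕ u_s ⊗ a)`.

## Sources

* S. A. Cook, R. A. Reckhow, *The relative efficiency of propositional proof systems*,
  J. Symbolic Logic 44 (1979), §2.
* J. Krajíček, *Bounded Arithmetic, Propositional Logic, and Complexity Theory* (CUP 1995), §9.2.
-/

namespace Literature.Computability.MetaComplexity

open _root_.Computability Complexity Complexity.PropForm Netlist Cluster FregeSystem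

namespace ModMulU

namespace Comm

namespace Stage

section Segs

variable (L : ℕ) (o : Occ) (K : PropForm ℕ) (m s : ℕ) (N N' : View)

/-- The bit `b_{L-1-s}`. [folklore] -/
def cbit : ℕ := o.inp (L + (L - 1 - s))
/-- `M_{s+1}`. [folklore] -/
def M' : View := M L o (s + 1)
/-- The pieces of `LD1_s`. [folklore] -/
def VX1 : View := LD.VX L (LD1 L o s)
/-- The pieces of `LD1_s`. [folklore] -/
def VY1 : View := LD.VY L (LD1 L o s)
/-- The pieces of `LD1_s`. [folklore] -/
def VS1 : View := LD.VS L (LD1 L o s)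
/-- The pieces of `LD1_s`. [folklore] -/
def RL1 : ModAddU.View := LD.RL L (LD1 L o s)
/-- The pieces of `LD2_s`. [folklore] -/
def VX2 : View := LD.VX L (LD2 L o s)
/-- The pieces of `LD2_s`. [folklore] -/
def VY2 : View := LD.VY L (LD2 L o s)
/-- The pieces of `LD2_s`. [folklore] -/
def VS2 : View := LD.VS L (LD2 L o s)
/-- The pieces of `LD2_s`. [folklore] -/
def RL2 : ModAddU.View := LD.RL L (LD2 L o s)

/-- The segments of stage `s` (after the word facts). [folklore] -/
def segs : List (List (PropForm ℕ)) :=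
  [(Comm.segs L o K s).flatten,                                                                     -- 0 word facts
   LD.lines L (LD1 L o s) K m,                                                                      -- 1
   LD.lines L (LD2 L o s) K m,                                                                      -- 2
   One.lines L (OneA L o) K (VY2 L o s) (cbit L o s) o.base,                                        -- 3
   ShiftMul.lines L K (M L o s) (M' L o s) (L - s) (zv L o),                                        -- 4
   Adder.reflLines K ((List.range L).map (av o) ++ (List.range L).map (nv L o) ++ (List.range L).map (R1 L o s)),   -- 5
   ModAddU.MFI.transLines K ((M' L o s).P L (L - 1)) ((VX1 L o s).P L L) L,                         -- 6
   ModAddU.MFI.transLines K ((M' L o s).P L (L - 1)) ((VY1 L o s).P L L) L,                         -- 7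
   (⟨(M' L o s).Dv L (L - 1), RL1 L o s, L⟩ : ModAddU.PairData).leibLines K,                        -- 8
   ModAddU.MFI.symmLines K ((VS1 L o s).P L L) ((RL1 L o s).R L) L,                                 -- 9
   (⟨VS1 L o s, VX2 L o s, L⟩ : PairData).lines K,                                                  -- 10
   ModAddU.MFI.transLines K (((M' L o s).Dv L (L - 1)).R L) ((VS1 L o s).P L L) L,                  -- 11
   ModAddU.MFI.transLines K (((M' L o s).Dv L (L - 1)).R L) ((VX2 L o s).P L L) L,                  -- 12
   (List.range L).map (fun i => ctx K (eqv ((M' L o s).msk L (L - 1) i) ((VY2 L o s).P L L i))),   -- 13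
   (⟨(M' L o s).Av L (L - 1), RL2 L o s, L⟩ : ModAddU.PairData).leibLines K,                        -- 14
   ModAddU.MFI.symmLines K ((VS2 L o s).P L L) ((RL2 L o s).R L) L,                                 -- 15
   ModAddU.MFI.transLines K (((M' L o s).Av L (L - 1)).R L) ((VS2 L o s).P L L) L,                  -- 16
   (⟨VS2 L o s, N, L⟩ : PairData).lines K,                                                          -- 17
   (⟨VS2 L o s, N', L⟩ : PairData).lines K,                                                         -- 18
   ModAddU.MFI.transLines K (((M' L o s).Av L (L - 1)).R L) (N.P L L) L,                            -- 19
   ModAddU.MFI.transLines K (((M' L o s).Av L (L - 1)).R L) (N'.P L L) L]                           -- 20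

end Segs

/-- The length of the segment list. [folklore] -/
theorem length_segs (L : ℕ) (o : Occ) (K : PropForm ℕ) (m s : ℕ) (N N' : View) : (segs L o K m s N N').length = 21 := rfl

variable {L : ℕ} {o : Occ} {K : PropForm ℕ} {G : FregeSystem} {T : Set (PropForm ℕ)}

/-- **Stage `s` of the commutativity law.** [cite: CookReckhow1979, §2; Krajicek1995, §9.2] -/
theorem isBlock_segs (hGC : ∀ r ∈ rules, r ∈ G.rules) (hGO : ∀ r ∈ One.rules, r ∈ G.rules) (hGS : ∀ r ∈ Sys.glue, r ∈ G.rules)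
    (hGY : ∀ r ∈ Sys.sysRules, r ∈ G.rules) (hGN : ∀ r ∈ Netlist.rules, r ∈ G.rules) (hGA : ∀ r ∈ Adder.rules, r ∈ G.rules)
    (hGL : ∀ r ∈ Logic.rules, r ∈ G.rules) (hG : ∀ r ∈ ModAddU.assocRules, r ∈ G.rules) (hGM : ∀ r ∈ ModAddU.rules, r ∈ G.rules)
    (hGR : ∀ r ∈ rangeRules, r ∈ G.rules) (hGG : ∀ r ∈ ModAddU.glueRules, r ∈ G.rules) (hGK : ∀ r ∈ LD.maskRules, r ∈ G.rules)
    (hL : 0 < L) (h : CAvail L o K T) {m s : ℕ} (hm : m + 2 ≤ L) (hs : s < L) {N N' : View} (hN : N.Avail L K T) (hN' : N'.Avail L K T)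
    (hNa : ∀ i < L, N.a i = B' L o s i) (hNb : ∀ i < L, N.b i = o.inp i) (hNn : ∀ i < L, N.n i = nv L o i)
    (hN'a : ∀ i < L, N'.a i = B' L o s i) (hN'b : ∀ i < L, N'.b i = o.inp i) (hN'n : ∀ i < L, N'.n i = nv L o i)
    (hz : ctx K (neg (var (zv L o))) ∈ T) (hzdef : ctx K (biimp (var (zv L o)) (const false)) ∈ T)
    (hCAB : ∀ k ≤ L, (CAB L o k).Avail K T L) (hltB : ∀ k ≤ L, ctx K (neg (var ((CAB L o k).ge L L))) ∈ T)
    (hltA : ctx K (neg (var ((CmpA L o).ge L L))) ∈ T) (hnh : ∀ i, m ≤ i → i < L → ctx K (neg (var (nv L o i))) ∈ T)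
    (hIH1 : ∀ i < L, ctx K (eqv ((M L o s).P L L i) ((VX1 L o s).P L L i)) ∈ T)
    (hIH2 : ∀ i < L, ctx K (eqv ((M L o s).P L L i) ((VY1 L o s).P L L i)) ∈ T) :
    G.IsBlock T (segs L o K m s N N').flatten := by
  have h1 := LD.avail_ofOcc (h.hLD1 s hs)
  have h2 := LD.avail_ofOcc (h.hLD2 s hs)
  have hM' : (M' L o s).RAvail L K T := h.hM (s + 1) hs
  have hMs : (M L o s).RAvail L K T := h.hM s hs.le
  have hL1 : L - 1 < L := by omega
  refine ModAddU.AssocData.isBlock_flatten _ fun k hk => ?_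
  rw [length_segs] at hk
  have mem : ∀ {χ} (j : ℕ) (hj : j < k) (hχ : χ ∈ (segs L o K m s N N')[j]'(by rw [length_segs]; omega)),
      χ ∈ T ∪ {χ | ∃ j, ∃ hj : j < k, χ ∈ (segs L o K m s N N')[j]'(by rw [length_segs]; omega)} := fun j hj hχ => Or.inr ⟨j, hj, hχ⟩
  have hΓ : T ⊆ T ∪ {χ | ∃ j, ∃ hj : j < k, χ ∈ (segs L o K m s N N')[j]'(by rw [length_segs]; omega)} := fun _ hχ => Or.inl hχ
  have mr : ∀ {f : ℕ → PropForm ℕ} {W i : ℕ}, i < W → f i ∈ (List.range W).map f := fun hi => List.mem_map.2 ⟨_, List.mem_range.2 hi, rfl⟩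
  -- reflexivity lines
  have rf : 5 < k → ∀ (w : ℕ) (z : ℕ → ℕ), (w = 0 ∧ z = av o ∨ w = 1 ∧ z = nv L o ∨ w = 2 ∧ z = R1 L o s) → ∀ i < L,
      ctx K (eqv (z i) (z i)) ∈ T ∪ {χ | ∃ j, ∃ hj : j < k, χ ∈ (segs L o K m s N N')[j]'(by rw [length_segs]; omega)} := by
    intro hk0 w z hz i hi
    refine mem 5 hk0 (Adder.mem_reflLines ?_)
    simp only [List.mem_append, List.mem_map, List.mem_range]
    rcases hz with ⟨-, rfl⟩ | ⟨-, rfl⟩ | ⟨-, rfl⟩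
    · exact Or.inl (Or.inl ⟨i, hi, rfl⟩)
    · exact Or.inl (Or.inr ⟨i, hi, rfl⟩)
    · exact Or.inr ⟨i, hi, rfl⟩
  interval_cases k
  · -- 0: the word facts
    exact Comm.isBlock_segs hGC hGO hGS hGY hGN hGA hGL hL (by exact ⟨h.hA.mono hΓ, h.hB.mono hΓ, h.hShB.mono hΓ, h.hOneA.mono hΓ,
      fun s hs => (h.hM s hs).mono hΓ, fun s hs => (h.hLD1 s hs).mono hΓ, fun s hs => (h.hLD2 s hs).mono hΓ, h.hBA.mono hΓ⟩) hs (hΓ hz)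
      (fun k hk => (hCAB k hk).mono hΓ) (fun k hk => hΓ (hltB k hk)) (hΓ hltA)
  · -- 1: distributivity for `LD1_s`
    refine LD.isBlock_lines hG hGM hGR hGN hGA hGL hGG hGK (h1.mono hΓ) hm (mem 0 (by omega) (mem_segs hL1).2.2.2.1)
      (mem 0 (by omega) (mem_segs hL1).2.2.2.2.1) fun i h₁ h₂ => ?_
    show ctx K (neg (var ((LD1 L o s).inp (3 * L + i)))) ∈ _
    rw [(LD1_inp hs h₂).2.2.2]; exact hΓ (hnh i h₁ h₂)
  · -- 2: distributivity for `LD2_s`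
    refine LD.isBlock_lines hG hGM hGR hGN hGA hGL hGG hGK (h2.mono hΓ) hm (mem 0 (by omega) (mem_segs hL1).2.1)
      (mem 0 (by omega) (mem_segs hL1).2.2.1) fun i h₁ h₂ => ?_
    show ctx K (neg (var ((LD2 L o s).inp (3 * L + i)))) ∈ _
    rw [(LD2_inp hL hs h₂).2.2.2]; exact hΓ (hnh i h₁ h₂)
  · -- 3: the unit law on `u_s ⊗ a`
    refine One.isBlock_lines hGO hGS hGY hGL (h.hOneA.mono hΓ) (h2.hVY.hV.mono hΓ) ?_ (fun i h₁ h₂ => ?_) (fun j hj => ?_) (fun i hi => ?_)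
      ?_ ?_ ?_ hL
    · exact (LD2_inp hL hs hL).2.1
    · obtain ⟨j, rfl⟩ : ∃ j, i = j + 1 := ⟨i - 1, by omega⟩
      show (LD2 L o s).inp (L + (j + 1)) = One.zg L (OneA L o)
      rw [(LD2_inp hL hs h₂).2.1, uw_succ]; unfold One.zg zv; rw [OneA_inp (by omega), if_neg (by omega), if_neg (by omega)]
    · show (LD2 L o s).inp (2 * L + j) = (OneA L o).inp j
      rw [(LD2_inp hL hs hj).2.2.1, OneA_inp (by omega), if_pos hj]
    · show (LD2 L o s).inp (3 * L + i) = One.nw L (OneA L o) i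
      rw [(LD2_inp hL hs hi).2.2.2]; unfold One.nw; rw [OneA_inp (by omega), if_neg (by omega), if_pos (by omega)]; congr 1; omega
    · have e : One.zg L (OneA L o) = zv L o := by unfold One.zg zv; rw [OneA_inp (by omega), if_neg (by omega), if_neg (by omega)]
      rw [e]; exact hΓ hzdef
    · refine Sub.View.Avail.congr (h.hA.mono hΓ) rfl (fun i hi => ?_) (fun i hi => ?_)
      · show One.Aw L (OneA L o) 0 i = o.inp i
        unfold One.Aw; rw [if_pos (by omega), OneA_inp (by omega), if_pos (by omega), Nat.add_zero]
      · show One.nw L (OneA L o) i = o.inp (2 * L + i)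
        unfold One.nw; rw [OneA_inp (by omega), if_neg (by omega), if_pos (by omega)]; congr 1; omega
    · exact hΓ hltA
  · -- 4: the shift law on `M_s`, `M_{s+1}`
    refine ShiftMul.isBlock_lines hGK hGN hGA hGL (hMs.mono hΓ) (hM'.mono hΓ) (by omega) (by omega) (fun i hi => rfl) (fun i hi => rfl)
      (fun t ht => ?_) (fun t ht => ?_) (fun t ht1 ht2 => ?_) (hΓ hzdef) (mem 0 (by omega) (mem_segs hL1).2.2.2.2.2.1)
      (mem 0 (by omega) (mem_segs hL1).2.2.2.2.2.2)
    · show Bw L o (L - s) (L - 1 - t) = zv L o; unfold Bw zv; rw [if_neg (by omega)]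
    · show Bw L o (L - (s + 1)) (L - 1 - t) = zv L o; unfold Bw zv; rw [if_neg (by omega)]
    · show Bw L o (L - (s + 1)) (L - 1 - t) = Bw L o (L - s) (L - 1 - (t + 1))
      unfold Bw; simp only [show L - 1 - t + (L - (s + 1)) = L - 1 - (t + 1) + (L - s) by omega]
  · -- 5: reflexivity
    exact Adder.isBlock_reflLines hGA _ _ _
  · -- 6: `P_{L-1}(M') ≡ P_L(VX1)`
    exact ModAddU.MFI.isBlock_transLines hGL K (fun i hi => mem 4 (by omega) (ShiftMul.mem_lines (by omega) (by omega) hi)) fun i hi => hΓ (hIH1 i hi)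
  · -- 7: `P_{L-1}(M') ≡ P_L(VY1)`
    exact ModAddU.MFI.isBlock_transLines hGL K (fun i hi => mem 4 (by omega) (ShiftMul.mem_lines (by omega) (by omega) hi)) fun i hi => hΓ (hIH2 i hi)
  · -- 8: `Dv_{L-1}(M') ≡ RL1`
    refine (⟨(M' L o s).Dv L (L - 1), RL1 L o s, L⟩ : ModAddU.PairData).isBlock_leibLines hGN hGL ((hM'.hV.hD _ hL1).mono hΓ)
      (h1.hRL.mono hΓ) (fun i hi => mem 6 (by omega) (mr hi)) (fun i hi => mem 7 (by omega) (mr hi)) fun i hi => ?_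
    show ctx K (eqv (nv L o i) ((LD1 L o s).inp (3 * L + i))) ∈ _
    rw [(LD1_inp hs hi).2.2.2]; exact rf (by omega) 1 (nv L o) (by simp) i hi
  · -- 9: `RL1.R ≡ VS1.out`
    exact ModAddU.MFI.isBlock_symmLines hGL K fun i hi => mem 1 (by omega) (LD.mem_lines hi)
  · -- 10: `VS1 ≡ VX2` (same operands)
    refine (⟨VS1 L o s, VX2 L o s, L⟩ : PairData).isBlock_lines hGN hGL (h1.hVS.hV.mono hΓ) (h2.hVX.hV.mono hΓ)
      (fun i hi => ?_) (fun i hi => ?_) (fun i hi => ?_)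
    · show ctx K (eqv ((LD.MS L (LD1 L o s)).R L i) ((LD2 L o s).inp i)) ∈ _
      rw [(LD2_inp hL hs hi).1]; exact rf (by omega) 2 (R1 L o s) (by simp) i hi
    · show ctx K (eqv ((LD1 L o s).inp (2 * L + i)) ((LD2 L o s).inp (2 * L + i))) ∈ _
      rw [(LD1_inp hs hi).2.2.1, (LD2_inp hL hs hi).2.2.1]; exact rf (by omega) 0 (av o) (by simp) i hi
    · show ctx K (eqv ((LD1 L o s).inp (3 * L + i)) ((LD2 L o s).inp (3 * L + i))) ∈ _
      rw [(LD1_inp hs hi).2.2.2, (LD2_inp hL hs hi).2.2.2]; exact rf (by omega) 1 (nv L o) (by simp) i hi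
  · -- 11: `R(Dv_{L-1}(M')) ≡ VS1.out`
    exact ModAddU.MFI.isBlock_transLines hGL K
      (fun i hi => mem 8 (by omega) ((⟨(M' L o s).Dv L (L - 1), RL1 L o s, L⟩ : ModAddU.PairData).mem_leibLines hi))
      (fun i hi => mem 9 (by omega) (mr hi))
  · -- 12: `R(Dv_{L-1}(M')) ≡ VX2.out`
    exact ModAddU.MFI.isBlock_transLines hGL K (fun i hi => mem 11 (by omega) (mr hi))
      (fun i hi => mem 10 (by omega) ((⟨VS1 L o s, VX2 L o s, L⟩ : PairData).mem_lines hi))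
  · -- 13: the masks of `M'`'s last stage are `VY2.out = b' ∧ a`
    refine Scaffold.isBlock_of_forall fun θ hθ => ?_
    obtain ⟨i, hi, rfl⟩ := List.mem_map.1 hθ
    rw [List.mem_range] at hi
    refine Or.inr (One.infer hGO 8 (by decide) (FregeSystem.sub [K, var ((M' L o s).msk L (L - 1) i), var ((VY2 L o s).P L L i),
      var (cbit L o s), var (o.inp i)]) rfl fun ψ hψ => ?_)
    simp only [One.rules, List.getElem_cons_succ, List.getElem_cons_zero, One.rMaskEqv, List.mem_cons, List.not_mem_nil, or_false] at hψ
    rcases hψ with rfl | rfl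
    · have := hM'.hV.hmk (L - 1) hL1 i hi
      rw [View.mkDef, show (M' L o s).b (L - 1 - (L - 1)) = cbit L o s from by
        show Bw L o (L - (s + 1)) (L - 1 - (L - 1)) = _; rw [Nat.sub_self]; unfold cbit; rw [Bw_zero_idx (by omega)]; congr 1; omega] at this
      exact hΓ this
    · have := One.mem_lines (L := L) (o := OneA L o) (K := K) (V := VY2 L o s) (c := cbit L o s) (bA := o.base) hi
      rw [OneA_inp (by omega), if_pos hi] at this
      exact mem 3 (by omega) this
  · -- 14: `Av_{L-1}(M') ≡ RL2`
    refine (⟨(M' L o s).Av L (L - 1), RL2 L o s, L⟩ : ModAddU.PairData).isBlock_leibLines hGN hGL ((hM'.hV.hA _ hL1).mono hΓ)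
      (h2.hRL.mono hΓ) (fun i hi => mem 12 (by omega) (mr hi)) (fun i hi => mem 13 (by omega) (mr hi)) fun i hi => ?_
    show ctx K (eqv (nv L o i) ((LD2 L o s).inp (3 * L + i))) ∈ _
    rw [(LD2_inp hL hs hi).2.2.2]; exact rf (by omega) 1 (nv L o) (by simp) i hi
  · -- 15: `RL2.R ≡ VS2.out`
    exact ModAddU.MFI.isBlock_symmLines hGL K fun i hi => mem 2 (by omega) (LD.mem_lines hi)
  · -- 16: `M'.out ≡ VS2.out`
    exact ModAddU.MFI.isBlock_transLines hGL K
      (fun i hi => mem 14 (by omega) ((⟨(M' L o s).Av L (L - 1), RL2 L o s, L⟩ : ModAddU.PairData).mem_leibLines hi))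
      (fun i hi => mem 15 (by omega) (mr hi))
  · -- 17: `VS2 ≡ N`
    refine (⟨VS2 L o s, N, L⟩ : PairData).isBlock_lines hGN hGL (h2.hVS.hV.mono hΓ) (hN.mono hΓ) (fun i hi => ?_) (fun i hi => ?_) (fun i hi => ?_)
    · rw [hNa i hi]; exact mem 0 (by omega) (mem_segs hi).1
    · show ctx K (eqv ((LD2 L o s).inp (2 * L + i)) (N.b i)) ∈ _
      rw [(LD2_inp hL hs hi).2.2.1, hNb i hi]; exact rf (by omega) 0 (av o) (by simp) i hi
    · show ctx K (eqv ((LD2 L o s).inp (3 * L + i)) (N.n i)) ∈ _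
      rw [(LD2_inp hL hs hi).2.2.2, hNn i hi]; exact rf (by omega) 1 (nv L o) (by simp) i hi
  · -- 18: `VS2 ≡ N'`
    refine (⟨VS2 L o s, N', L⟩ : PairData).isBlock_lines hGN hGL (h2.hVS.hV.mono hΓ) (hN'.mono hΓ) (fun i hi => ?_) (fun i hi => ?_) (fun i hi => ?_)
    · rw [hN'a i hi]; exact mem 0 (by omega) (mem_segs hi).1
    · show ctx K (eqv ((LD2 L o s).inp (2 * L + i)) (N'.b i)) ∈ _
      rw [(LD2_inp hL hs hi).2.2.1, hN'b i hi]; exact rf (by omega) 0 (av o) (by simp) i hi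
    · show ctx K (eqv ((LD2 L o s).inp (3 * L + i)) (N'.n i)) ∈ _
      rw [(LD2_inp hL hs hi).2.2.2, hN'n i hi]; exact rf (by omega) 1 (nv L o) (by simp) i hi
  · -- 19: `M'.out ≡ N.out`
    exact ModAddU.MFI.isBlock_transLines hGL K (fun i hi => mem 16 (by omega) (mr hi))
      (fun i hi => mem 17 (by omega) ((⟨VS2 L o s, N, L⟩ : PairData).mem_lines hi))
  · -- 20: `M'.out ≡ N'.out`
    exact ModAddU.MFI.isBlock_transLines hGL K (fun i hi => mem 16 (by omega) (mr hi))
      (fun i hi => mem 18 (by omega) ((⟨VS2 L o s, N', L⟩ : PairData).mem_lines hi))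

/-- **The conclusions of stage `s`**: `P_L(M_{s+1}) ≡ P_L(N)` and `≡ P_L(N')`. [folklore] -/
theorem mem_segs_out {m s : ℕ} {N N' : View} (hL : 0 < L) {i : ℕ} (hi : i < L) :
    ctx K (eqv ((M L o (s + 1)).P L L i) (N.P L L i)) ∈ (segs L o K m s N N').flatten ∧
    ctx K (eqv ((M L o (s + 1)).P L L i) (N'.P L L i)) ∈ (segs L o K m s N N').flatten := by
  have h21 : (segs L o K m s N N').length = 21 := rfl
  have e : (M L o (s + 1)).P L L i = ((M' L o s).Av L (L - 1)).R L i := by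
    rw [← View.P_succ, Nat.sub_add_cancel hL]; rfl
  rw [e]
  exact ⟨List.mem_flatten.2 ⟨_, List.getElem_mem (n := 19) (by omega), List.mem_map.2 ⟨i, List.mem_range.2 hi, rfl⟩⟩,
    List.mem_flatten.2 ⟨_, List.getElem_mem (n := 20) (by omega), List.mem_map.2 ⟨i, List.mem_range.2 hi, rfl⟩⟩⟩

end Stage

end Comm

end ModMulU

end Literature.Computability.MetaComplexity
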